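import Literature.MathematicalPhysics.QuantumFieldTheory.Balaban1983to89.B15Prop1FromModel
import Literature.MathematicalPhysics.QuantumFieldTheory.Balaban1983to89.B16Ineq17Assembly

/-!
# `Balaban1983to89.B15Prop1ModelCarrier` — T. Bałaban, *Large field renormalization. I. The basic step of the 𝐑 operation*,
Commun. Math. Phys. **122** (1989) 175–202 [Balaban1989LargeFieldI] («[IV]»), **Proposition 1** p. 194: the statement of
record `B15.Prop1Printed` INHABITED AT A CARRIER BUILT FROM ITS ONLY PRINTED PROOF ([Balaban1989LargeFieldII] («[LF-II]»)
pp. 358–359) — the `B15.LFVar` whose orbits ARE the gauge-fixed chart configurations `B′` of p. 359, whose criticality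
predicate IS the equation (1.12), whose minimality predicate IS «minimises the function over the chart»; `Prop1Printed` of
it from the located analytic inputs of p. 359 alone (no dictionary hypotheses), and a MODEL INSTANCE at which every input is
discharged (non-vacuity).

statement-level skeleton of published theorems with citation tags; proofs where landed; nothing here is a claim about
the Yang–Mills mass gap

Cell pub-ymgap, HUMAN RULING D-0062 (Track A full width), seat `pub-ymgap-dag-n12-c` (R134 acceleration seat (a), strategy
s1 of DAG node N12 = [B15]; director-ym R134 row «INHABIT `B15.Prop1Printed` :128 from the landed p.359 model
(`B16Prop1IVAssembly…`, `bounds167_*`, `B11Prop4ModelW80`)»; dag-lead FAN-OUT v1.1 §N12 s1).  Statement of record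
`Dag.B15_main`, leaf `DagBinding.B15Leaf W`, conjunct `p1 : B15.Prop1Printed W.LF`; at NODE 00's record (`Node00/CarriersW.lean`,
`Node00/Record11Carriers.lean`) the Proposition-1 carrier `ResidW.LF P : B15.LFVar` is an EXPLICIT RESIDUAL datum — the
display `WDisplays₁₀.hP1 : Prop1Printed (λ.LF P)` is what a closer must SUPPLY, and the degenerate residual inhabitant
`Node00.nonempty_residW` (`Inst := PEmpty`) supplies it only VACUOUSLY.  This module is the non-degenerate supply: a carrier
any closer can plug as `λ.LF P`, with `Prop1Printed` of it proved from print's inputs.  PDFs held: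
`paper:balaban1989-cmp122-large-field-i` (journal page = PDF page + 174; p. 194 = PDF 20),
`paper:balaban1989-cmp122-large-field-ii` (journal page = PDF page + 354; pp. 358–359 = PDF 4–5; text layer re-read by this
seat 2026-08-26).

THE PRINT.  [IV] p. 194, Proposition 1 (verbatim in `B15.Prop1Printed`): *«For a configuration V_k↾_{Z∩Λᶜ}, satisfying the
regularity condition |∂V_k − 1| < ε on the domain Z ∩ Λᶜ, for ε > 0 sufficiently small, there exists exactly one critical
orbit of the function (1.77). An element of the orbit is a minimum of the function, and is denoted by V_Λ = V_Λ(V_k↾_{Z∩Λᶜ}).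
It satisfies the regularity condition |V_Λ(∂p′) − 1| < B₅M⁵ε for p′ ∈ Λ. (1.78) The orbit-valued function V_Λ(V_k↾_{Z∩Λᶜ})
has an analytic extension …»*.  [LF-II] p. 359 [PDF 5]: *«Now we prove Proposition 1 [IV]. … V_k … has an extension from
Z∩Λᶜ onto Z, such that U_{k,Z}(V_k) satisfies the inequality in (1.75) [IV]. We fix such an extension, and we consider the
variational problem for the function V′↾_Λ → A(U_{k,Z}(V′V_k)), where V′ satisfies mild regularity conditions. Fixing the
gauge G₀ for V′ we get a small configuration, and we can write V′ = exp iB′. We expand the function with respect to B′ …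
Now the condition for a critical configuration is the equation ⟨δB′, H*_{1,k}J_{k,Z}⟩ + ⟨δB′, H*_{1,k}Δ₁H_{1,k}B′⟩ +
⟨δB′, H*_{1,k}((δ/δA)V)(H_{1,k}B′)⟩ = 0 (1.12) … Denote by P₀ the projection onto the subspace of B′ satisfying the gauge
condition B′↾_{G₀} = 0. By the inequality (1.9) the operator P₀H*_{1,k}Δ₁H_{1,k}P₀ is positive, hence invertible on this
subspace, and the inverse is bounded by γ₀⁻¹2d(100M)⁵. … Using Proposition 4 [15] and the fixed point theorem for
contractive mappings, we can easily prove that the above equation has exactly one solution, which has a bound equal to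
twice a bound of the right-hand side of the equation, i.e., it can be bounded by 2γ₀⁻¹2d(100M)⁵B₃²4ε_k. This proves the
existence and the uniqueness statements of Proposition 1 [IV], and the bound (1.78) [IV]. The above equations, bounds and
statements are valid for 𝔤ᶜ-valued fields, hence the existence of the analytic extension follows immediately, and
Proposition 1 [IV] is proved. It is proved for ε_k instead of a general ε, but the generalization is obvious.»*

STATE OF THE TREE BEFORE THIS FILE.  Every clause of the p. 359 argument is a kernel theorem in the abstract real-Hilbert
model of r13 ∕ r12 ∕ n12-b (`B16Prop1IVAssembly.prop1IV_model_of_pos`: existence, «twice a bound of the right-hand side»,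
the inverse from (1.9); `B15Prop1Minimum.le_of_critical` ∕ `lt_of_critical_of_ne`: the minimum; `B15Prop1FromModel.
critical_unique_of_chart`: uniqueness on the whole chart), and n12-b's `B15Prop1FromModel.prop1Printed_of_model` gives
`B15.Prop1Printed P` for EVERY carrier `P` equipped with a DICTIONARY to the model ((d1) `rep i W : P.Orbit i → E i` injective,
gauge-fixed, onto the chart ball; (d2) `P.IsCritical ↔ (1.12)`; (d3) `P.IsMinimum ⇐` minimiser) plus the located analytic
letters.  What had no theorem: a carrier ON WHICH the dictionary holds — i.e. an `LFVar` built from the model, with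
`Prop1Printed` of it.

WHAT THIS FILE PROVES (Mathlib + `B15Prop1FromModel`; no `sorry`, no `instance`, no `notation`, no `… : Prop` fact; the two
data structures and the two `def`s are model OBJECTS with bodies; axioms standard).
§1 `GaugeBall P₀ r` — the gauge-fixed chart ball `{B′ // P₀B′ = B′ ∧ ‖B′‖ ≤ r}` (*«Fixing the gauge G₀ for V′ we get a small
   configuration, and we can write V′ = exp iB′»*).  `ChartDatum ι Bd E F` — the p. 359 model data of a FAMILY of instances
   `i : ι` (= `(k, Z, Λ)` with its geometry): cube size `M i`, chart radius `r i`, the gauge projection `P₀ i`, and, per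
   boundary datum `W : Bd i` (= `V_k↾_{Z∩Λᶜ}` with its fixed extension), `H i W = H_{1,k}`, `Hst i W = H*_{1,k}`, `Δ₁ i W`,
   `dV i W = (δ/δA)V`, the current `J i W = J_{k,Z}`, the function `A i W` of (1.77) in the chart; the orbit carrier `Cfg i` with
   the `W`-chart `chart i W : GaugeBall (P₀ i) (r i) ≃ Cfg i` (`B′ ↦` the orbit of `exp(iB′)·Ṽ_k(W)` on `Λ`); the regularity
   predicate `Reg i ε W` (*«|∂V_k − 1| < ε on Z ∩ Λᶜ»*), the deviation `dev i : Cfg i → ℝ` (`sup_{p′∈Λ}|V_Λ(∂p′) − 1|`) and the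
   analytic-extension clause `AnExt i ε W`.  **`lfVarOfModel D : B15.LFVar`** — the carrier of record's TYPE inhabited by
   these objects: `Inst := ι`, `Bdry := Bd`, `Orbit := Cfg`, `Regular := Reg`, `IsCritical i W O :=` (1.12) at the chart
   coordinate `(chart i W)⁻¹ O`, `IsMinimum i W O :=` «`A i W` is minimal at `O` over the chart», `dev := dev`,
   `AnalyticExt := AnExt`; with its `rfl` ∕ `Iff.rfl` unfolding lemmas.
§2 **`prop1Printed_lfVarOfModel`** — `B15.Prop1Printed (lfVarOfModel D)` from the LOCATED inputs of p. 359 ONLY: (m1) the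
   (1.9) positivity on the gauge subspace with constant `γ/(M i)⁵` (print `γ₀/(2d(100M)⁵)`); (m2) `P₀` idempotent symmetric,
   `H*` the adjoint of `H`, `‖H‖ ≤ h₁`, `‖H*‖ ≤ hst` ((190) [15]); (m3) «Proposition 4 [15]»: `dV 0 = 0` and an `ℓ i`-Lipschitz
   bound on the ball of radius `ρ i ≥ h₁·r i`, with the contraction smallness `(M i)⁵/γ·hst·ℓ i·h₁ ≤ ½`; (m4) the current is
   small on regular data, `Reg i ε W → ‖J i W‖ ≤ cJ·ε` ((1.75) [IV] + (1.5)); (m5) the first variation of `A i W` is (1.12); (d4)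
   the chart deviation `Reg i ε W → dev i (chart i W B′) ≤ a‖B′‖ + b(M i)²ε` (p. 193 *«|∂V_k − 1| < O(1)M²ε»* for the extension);
   (x) the analytic-extension clause supplied below its threshold `eA i` (its model proof is the complex twin
   `B16Prop1IVFromProp4.prop1IV_complex`, not re-derived over `ℝ`).  NO dictionary hypothesis: (d1)–(d3) of n12-b hold BY
   CONSTRUCTION (`Equiv` ∕ `Iff.rfl` ∕ `id`).  BY NAME: `B15Prop1FromModel.prop1Printed_of_model`.  Constants as there:
   `B₅ := 2·a·hst·cJ/γ + b + 1` FIRST, then `e0 i := min (eA i) (r i/(2(M i)⁵hst·cJ/γ + 1))`.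
   `prop1Printed_lfVarOfModel_of_ineq19` — the same with (m1) fed BY NAME from r13's typed (1.9) `B16Sect1Wilson.Ineq19` at
   `d = 4` (n12-b's `hpos_of_ineq19`, `γ = γ₀/(8·100⁵)`).  `prop1Printed_lfVarOfModel_ell2` — the same under the `ℓ²` reading
   of the current `‖J i W‖ ≤ cJ·(M i)²·ε` when `M i ≤ M₀` (cell GAPS G-B16-02; `B₅` absorbs `M₀²`).
§3 **`scalarDatum`** — the ONE-INSTANCE SCALAR MODEL (`ι = PUnit`, `Bd = E = F = ℝ`, `P₀ = H = H* = Δ₁ = 1`, `V = 0`,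
   `J W = W`, `A W B′ = W·B′ + B′²/2`, chart = identity on `GaugeBall 1 1`, `Reg ε W := |W| ≤ ε`, `dev B′ := |B′|`, `AnExt ε W
   :=` «the critical configuration `W ↦ −W` is real-analytic at `W`»), at which EVERY input (m1)–(m5), (d4), (x) is DISCHARGED:
   **`prop1Printed_scalarDatum : B15.Prop1Printed (lfVarOfModel scalarDatum)`** unconditionally; and
   **`scalarDatum_nondegenerate`**: instances and orbits inhabited, two distinct orbits, `Regular i ε W` satisfiable with
   `W ≠ 0` at every `ε > 0`, and the critical orbit of datum `W` is exactly `B′ = −W` (so «exactly one critical orbit» has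
   content) — the A2 non-vacuity witness for the hypothesis set of §2 (contrast `Node00.not_b15Leaf_WOfRecord₁₀_swapLF`: a
   carrier with no orbits kills `p1`; `nonempty_residW`: a carrier with no instances makes it vacuous).

HONEST SCOPE (located, nothing repaired).  (i) Nothing of [IV]'s OBJECTS of record is constructed — neither `A(U_{k,Z}(·))`
on `SU(N)`-valued lattice fields, the gauge fixing `G₀` and the chart `exp iB′`, nor `H_{1,k}`, `Δ₁(ζ₀)`, `V`, `J_{k,Z}` (NODE 00
has no `LFOfRecord` at Stage 11: `ResidW.LF` is residual by design, `Node00/Record11Carriers.lean` header); `lfVarOfModel D` is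
the carrier of the MODEL `D`, and discharging (m1)–(m5), (d4), (x) at the objects of record is the located remainder ((m1) ⇐
(1.7) ∧ (1.8): `B16Ineq17Assembly.ineq19_of_inputs`, `B16Sect1Wilson.ineq18_cube_vec`, (1.67) [10] `B5Bounds167Lattice.
bounds167_formOfLattice`; (m3) ⇐ [15] Prop. 4: `B11Prop4ModelW80.prop4Printed_W80` on the (115) carriers, norm bridge to `ℓ²`
NOT made — G-B16-02).  (ii) As in n12-b's file, «orbit» = orbit OF THE CHART (`‖B′‖ ≤ r i`, `h₁r i ≤ ρ i`): `Cfg i` is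
equivalent to the chart ball by `chart i W` for every `W` — print's domain of (1.77) (*«mild regularity conditions»*) is a
priori wider; the p. 359 contraction argument gives no more.  (iii) The `M`-exponent 5 is print's; the honest `ℓ²`
bookkeeping is `prop1Printed_lfVarOfModel_ell2` ∕ `B16.prop1_chain_M7`.  (iv) §3 is a satisfiability witness, not physics.
NOT summit progress; count-neutral (`--supports` the (B)-side crux K1; N12 is discharged only by a knit at the record).
-/

noncomputable section

namespace Literature.MathematicalPhysics.QuantumFieldTheory.Balaban1983to89.B15Prop1ModelCarrier

open scoped RealInnerProductSpace
open Literature.MathematicalPhysics.QuantumFieldTheory.Balaban1983to89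

/-! ## §1 The carrier built from the p. 359 model data -/

/-- **The gauge-fixed chart ball** of p. 359: the configurations `B′` in the gauge subspace (`P₀B′ = B′`, *«the subspace
of B′ satisfying the gauge condition B′↾_{G₀} = 0»*) of norm `≤ r` (the Proposition-4 chart, *«Fixing the gauge G₀ for
V′ we get a small configuration, and we can write V′ = exp iB′»*). [cite: Balaban1989LargeFieldII, p.359 (proof of
Proposition 1 [IV])] -/
def GaugeBall {E : Type} [NormedAddCommGroup E] [InnerProductSpace ℝ E] (P₀ : E →ₗ[ℝ] E) (r : ℝ) : Type :=
  {B : E // P₀ B = B ∧ ‖B‖ ≤ r}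

/-- **The p. 359 model data of a family of instances** (data only, no law).  Instances `i : ι` (= the step `k`, the
large-field region `Z`, the domain `Λ` with its geometry); real inner-product spaces `E i` (𝔤-valued bond fields `B′` on `Λ`)
and `F i` (fields on the fine lattice); boundary data `W : Bd i` (= `V_k↾_{Z∩Λᶜ}` together with its fixed extension, p. 359
*«We fix such an extension»*).  Fields: the cube size `M` and chart radius `r`; the gauge projection `P₀`; per `W` the
operators `H = H_{1,k}`, `Hst = H*_{1,k}`, `Δ₁ = Δ₁(ζ₀)`, `dV = (δ/δA)V`, the current `J = J_{k,Z}` and the function `A` of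
(1.77) in the chart (*«V′↾_Λ → A(U_{k,Z}(V′V_k)) … We expand the function with respect to B′»*); the orbit carrier `Cfg`
(gauge orbits of configurations on `Λ` in the chart domain) with the `W`-chart `chart i W` (`B′ ↦` the orbit of
`exp(iB′)·Ṽ_k(W)↾_Λ`, a bijection from the gauge-fixed ball); the regularity predicate `Reg i ε W` (*«|∂V_k − 1| < ε on the
domain Z ∩ Λᶜ»*); the deviation `dev i O` (`sup_{p′∈Λ}|V_Λ(∂p′) − 1|` of (1.78)); the analytic-extension clause `AnExt`.
[cite: Balaban1989LargeFieldII, p.359 (proof of Proposition 1 [IV]), (1.12); Balaban1989LargeFieldI, (1.77)–(1.78) p.194] -/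
structure ChartDatum (ι : Type) (Bd E F : ι → Type)
    [∀ i, NormedAddCommGroup (E i)] [∀ i, InnerProductSpace ℝ (E i)]
    [∀ i, NormedAddCommGroup (F i)] [∀ i, InnerProductSpace ℝ (F i)] where
  /-- the cube size `M` of the instance ([IV] p. 177; `Λ` lies in a cube of size `100M`) -/
  M : ι → ℝ
  /-- the radius `r` of the Proposition-4 chart `‖B′‖ ≤ r` -/
  r : ι → ℝ
  /-- the gauge projection `P₀` onto `{B′ | B′↾_{G₀} = 0}` -/
  P₀ : (i : ι) → (E i →ₗ[ℝ] E i)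
  /-- `H_{1,k}` -/
  H : (i : ι) → Bd i → (E i →ₗ[ℝ] F i)
  /-- `H*_{1,k}` -/
  Hst : (i : ι) → Bd i → (F i →ₗ[ℝ] E i)
  /-- `Δ₁ = Δ₁(ζ₀)`, `ζ₀ = 1` -/
  Δ₁ : (i : ι) → Bd i → (F i →ₗ[ℝ] F i)
  /-- `(δ/δA)V` -/
  dV : (i : ι) → Bd i → F i → F i
  /-- the current `J_{k,Z}` of the fixed extension of `W` -/
  J : (i : ι) → Bd i → F i
  /-- the function (1.77) in the chart, `B′ ↦ A(U_{k,Z}(exp(iB′)·Ṽ_k(W)))` -/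
  A : (i : ι) → Bd i → E i → ℝ
  /-- the orbit carrier: gauge orbits of configurations `V_k↾_Λ` on `Λ` (in the chart domain) -/
  Cfg : ι → Type
  /-- the `W`-chart: gauge-fixed `B′` of the ball `↦` the orbit of `exp(iB′)·Ṽ_k(W)↾_Λ` -/
  chart : (i : ι) → Bd i → (GaugeBall (P₀ i) (r i) ≃ Cfg i)
  /-- the regularity predicate «|∂V_k − 1| < ε on Z ∩ Λᶜ» of the boundary datum -/
  Reg : (i : ι) → ℝ → Bd i → Prop
  /-- the deviation `sup_{p′∈Λ}|V_Λ(∂p′) − 1|` of an orbit -/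
  dev : (i : ι) → Cfg i → ℝ
  /-- the analytic-extension clause of Proposition 1 at `(i, ε, W)` -/
  AnExt : (i : ι) → ℝ → Bd i → Prop

section Carrier

variable {ι : Type} {Bd E F : ι → Type}
  [∀ i, NormedAddCommGroup (E i)] [∀ i, InnerProductSpace ℝ (E i)]
  [∀ i, NormedAddCommGroup (F i)] [∀ i, InnerProductSpace ℝ (F i)]

/-- **The Proposition-1 carrier BUILT FROM THE MODEL**: the `B15.LFVar` whose instances, boundary data and cube sizes are the
datum's, whose ORBITS are the orbit carrier `Cfg i` (charted by the gauge-fixed ball), whose CRITICALITY predicate at the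
boundary datum `W` IS the printed equation (1.12) for the chart coordinate `B′ = (chart i W)⁻¹ O` (*«the condition for a
critical configuration is the equation (1.12)»*), whose MINIMALITY predicate IS «the function `A i W` of (1.77) is minimal at
`O` among the orbits of the chart» (*«An element of the orbit is a minimum of the function»*), whose deviation, regularity and
analytic-extension predicates are the datum's.
[cite: Balaban1989LargeFieldI, Prop. 1 (1.77)–(1.78) p.194; Balaban1989LargeFieldII, (1.12) p.359] -/
def lfVarOfModel (D : ChartDatum ι Bd E F) : B15.LFVar where
  Inst := ι
  M := D.M
  Bdry := Bd
  Orbit := D.Cfg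
  Regular := D.Reg
  IsCritical i W O := ∀ δB : E i, D.P₀ i δB = δB →
    ⟪δB, D.Hst i W (D.J i W)⟫ + ⟪δB, D.Hst i W (D.Δ₁ i W (D.H i W ((D.chart i W).symm O).1))⟫ +
      ⟪δB, D.Hst i W (D.dV i W (D.H i W ((D.chart i W).symm O).1))⟫ = 0
  IsMinimum i W O := ∀ O' : D.Cfg i, D.A i W ((D.chart i W).symm O).1 ≤ D.A i W ((D.chart i W).symm O').1
  dev := D.dev
  AnalyticExt := D.AnExt

/-- Unfolding: the instances of the carrier are the datum's index type. [cite: Balaban1989LargeFieldI, Prop. 1 p.194 (bookkeeping)] -/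
theorem lfVarOfModel_inst (D : ChartDatum ι Bd E F) : (lfVarOfModel D).Inst = ι := rfl

/-- Unfolding: the cube size of the carrier is the datum's `M`. [cite: Balaban1989LargeFieldI, Prop. 1 (1.78) p.194 (bookkeeping)] -/
theorem lfVarOfModel_M (D : ChartDatum ι Bd E F) (i : ι) : (lfVarOfModel D).M i = D.M i := rfl

/-- Unfolding: the orbits of the carrier are the orbit carrier `Cfg`. [cite: Balaban1989LargeFieldI, Prop. 1 p.194 (bookkeeping)] -/
theorem lfVarOfModel_orbit (D : ChartDatum ι Bd E F) (i : ι) : (lfVarOfModel D).Orbit i = D.Cfg i := rfl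

/-- Unfolding: regularity of a boundary datum is the datum's `Reg`. [cite: Balaban1989LargeFieldI, Prop. 1 p.194 (bookkeeping)] -/
theorem lfVarOfModel_regular_iff (D : ChartDatum ι Bd E F) (i : ι) (ε : ℝ) (W : Bd i) :
    (lfVarOfModel D).Regular i ε W ↔ D.Reg i ε W := Iff.rfl

/-- Unfolding: **criticality IS (1.12)** at the chart coordinate of the orbit. [cite: Balaban1989LargeFieldII, (1.12) p.359] -/
theorem lfVarOfModel_isCritical_iff (D : ChartDatum ι Bd E F) (i : ι) (W : Bd i) (O : D.Cfg i) :
    (lfVarOfModel D).IsCritical i W O ↔ ∀ δB : E i, D.P₀ i δB = δB →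
      ⟪δB, D.Hst i W (D.J i W)⟫ + ⟪δB, D.Hst i W (D.Δ₁ i W (D.H i W ((D.chart i W).symm O).1))⟫ +
        ⟪δB, D.Hst i W (D.dV i W (D.H i W ((D.chart i W).symm O).1))⟫ = 0 := Iff.rfl

/-- Unfolding: **minimality IS «minimal over the chart»**. [cite: Balaban1989LargeFieldI, Prop. 1 p.194 («An element of the
orbit is a minimum of the function»)] -/
theorem lfVarOfModel_isMinimum_iff (D : ChartDatum ι Bd E F) (i : ι) (W : Bd i) (O : D.Cfg i) :
    (lfVarOfModel D).IsMinimum i W O ↔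
      ∀ O' : D.Cfg i, D.A i W ((D.chart i W).symm O).1 ≤ D.A i W ((D.chart i W).symm O').1 := Iff.rfl

/-- Unfolding: the deviation of the carrier is the datum's `dev`. [cite: Balaban1989LargeFieldI, (1.78) p.194 (bookkeeping)] -/
theorem lfVarOfModel_dev (D : ChartDatum ι Bd E F) (i : ι) (O : D.Cfg i) : (lfVarOfModel D).dev i O = D.dev i O := rfl

/-- Unfolding: the analytic-extension clause of the carrier is the datum's `AnExt`. [cite: Balaban1989LargeFieldI, Prop. 1
p.194 (bookkeeping)] -/
theorem lfVarOfModel_analyticExt_iff (D : ChartDatum ι Bd E F) (i : ι) (ε : ℝ) (W : Bd i) :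
    (lfVarOfModel D).AnalyticExt i ε W ↔ D.AnExt i ε W := Iff.rfl

/-! ## §2 `B15.Prop1Printed` of the model carrier, from the located inputs of p. 359 only -/

/-- **Proposition 1 of [Balaban1989LargeFieldI] — the statement of record `B15.Prop1Printed` — HOLDS ON THE CARRIER BUILT FROM
THE p. 359 MODEL**, from print's located inputs and nothing else: (m1) the (1.9) positivity `γ/(M i)⁵·‖B′‖² ≤ ⟨HB′, Δ₁HB′⟩` on the
gauge subspace (*«By the inequality (1.9) the operator P₀H*Δ₁HP₀ is positive, hence invertible … the inverse is bounded by
γ₀⁻¹2d(100M)⁵»*); (m2) `P₀` idempotent symmetric, `H*` the adjoint of `H`, `‖H‖ ≤ h₁`, `‖H*‖ ≤ hst`; (m3) *«Proposition 4 [15]»*: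
`dV 0 = 0`, `dV` is `ℓ i`-Lipschitz on the ball of radius `ρ i ≥ h₁·r i`, and the contraction smallness
`(M i)⁵/γ·hst·ℓ i·h₁ ≤ ½`; (m4) on `ε`-regular boundary data the current is small, `‖J i W‖ ≤ cJ·ε` (print: `B₃²4ε_k` with
`hst = B₃`); (m5) the first variation of `A i W` at `B′` in the direction `δB′` is the left side of (1.12); (d4) on `ε`-regular
data the deviation of the orbit charted by `B′` is `≤ a‖B′‖ + b(M i)²ε` (chart + the p. 193 extension bound); (x) the
analytic-extension clause holds on `ε`-regular data for `ε ≤ eA i`; `1 ≤ M i`, `0 < r i`.  Then `B15.Prop1Printed (lfVarOfModel D)`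
with `B₅ = 2·a·hst·cJ/γ + b + 1` and thresholds `e0 i = min (eA i) (r i/(2(M i)⁵hst·cJ/γ + 1))`.  BY NAME: n12-b's
`B15Prop1FromModel.prop1Printed_of_model` with the dictionary (d1)–(d3) discharged BY CONSTRUCTION (`rep i W = (chart i W)⁻¹`,
an `Equiv` onto the gauge-fixed ball; `IsCritical ↔ (1.12)` and `IsMinimum` by `Iff.rfl`). [cite: Balaban1989LargeFieldI,
Prop. 1 (1.78) p.194; Balaban1989LargeFieldII, pp.358–359 (proof of Proposition 1 [IV]), (1.9), (1.12)–(1.13);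
Balaban1985Variational, Prop. 4 p.293] -/
theorem prop1Printed_lfVarOfModel [∀ i, FiniteDimensional ℝ (E i)] (D : ChartDatum ι Bd E F)
    (hP2 : ∀ i x, D.P₀ i (D.P₀ i x) = D.P₀ i x) (hPsa : ∀ i (x y : E i), ⟪D.P₀ i x, y⟫ = ⟪x, D.P₀ i y⟫)
    (hadj : ∀ i W (x : E i) (y : F i), ⟪D.H i W x, y⟫ = ⟪x, D.Hst i W y⟫)
    {γ h₁ hst cJ a b : ℝ} (hγ : 0 < γ) (hh₁ : 0 ≤ h₁) (hhst : 0 ≤ hst) (hcJ : 0 ≤ cJ) (ha : 0 ≤ a) (hb : 0 ≤ b)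
    {ℓ ρ eA : ι → ℝ} (hℓ : ∀ i, 0 ≤ ℓ i) (hr : ∀ i, 0 < D.r i) (heA : ∀ i, 0 < eA i) (hM : ∀ i, 1 ≤ D.M i)
    (hpos : ∀ i W x, D.P₀ i x = x → γ / D.M i ^ 5 * ‖x‖ ^ 2 ≤ ⟪D.H i W x, D.Δ₁ i W (D.H i W x)⟫)
    (hH : ∀ i W x, ‖D.H i W x‖ ≤ h₁ * ‖x‖) (hHst : ∀ i W z, ‖D.Hst i W z‖ ≤ hst * ‖z‖)
    (hdV0 : ∀ i W, D.dV i W 0 = 0)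
    (hdV : ∀ i W (u v : F i), ‖u‖ ≤ ρ i → ‖v‖ ≤ ρ i → ‖D.dV i W u - D.dV i W v‖ ≤ ℓ i * ‖u - v‖)
    (hρ : ∀ i, h₁ * D.r i ≤ ρ i) (hsmall : ∀ i, D.M i ^ 5 / γ * hst * ℓ i * h₁ ≤ 1 / 2)
    (hA : ∀ i W (X δ : E i), HasDerivAt (fun s : ℝ => D.A i W (X + s • δ))
      (⟪δ, D.Hst i W (D.J i W)⟫ + ⟪δ, D.Hst i W (D.Δ₁ i W (D.H i W X))⟫ + ⟪δ, D.Hst i W (D.dV i W (D.H i W X))⟫) 0)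
    (hJ : ∀ i ε W, 0 < ε → D.Reg i ε W → ‖D.J i W‖ ≤ cJ * ε)
    (hdev : ∀ i ε W (B : GaugeBall (D.P₀ i) (D.r i)), 0 < ε → D.Reg i ε W →
      D.dev i (D.chart i W B) ≤ a * ‖(B.1 : E i)‖ + b * D.M i ^ 2 * ε)
    (hAn : ∀ i ε W, 0 < ε → ε ≤ eA i → D.Reg i ε W → D.AnExt i ε W) :
    B15.Prop1Printed (lfVarOfModel D) := by
  refine B15Prop1FromModel.prop1Printed_of_model (lfVarOfModel D) (E := E) (F := F) (fun i _ => D.P₀ i)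
    (fun i _ x => hP2 i x) (fun i _ x y => hPsa i x y) D.H D.Hst hadj D.Δ₁ D.dV D.J D.A hγ hh₁ hhst hcJ ha hb
    (r := D.r) hℓ hr heA hM hpos hH hHst hdV0 hdV hρ hsmall hA hJ (fun i W O => ((D.chart i W).symm O).1)
    (fun i W O => ((D.chart i W).symm O).2.1) (fun i W O => ((D.chart i W).symm O).2.2) ?_ ?_
    (fun i W O => Iff.rfl) (fun i W O h => h) ?_ hAn
  · -- (d1) injective: the chart is a bijection and the ball a subtype
    intro i W O₁ O₂ h
    exact (D.chart i W).symm.injective (Subtype.ext h)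
  · -- (d1) onto the gauge-fixed ball
    intro i W B hB hBn
    exact ⟨D.chart i W ⟨B, hB, hBn⟩, by rw [Equiv.symm_apply_apply]⟩
  · -- (d4) at the orbit `O = chart i W ((chart i W)⁻¹ O)`
    intro i ε W O hε hW
    have h := hdev i ε W ((D.chart i W).symm O) hε hW
    rwa [Equiv.apply_symm_apply] at h

/-- **The same with (m1) fed BY NAME from the typed (1.9).**  r13's leaf `B16Sect1Wilson.Ineq19 Q ‖B′‖² γ₀ d M` (*«⟨H_{1,k}B′,
Δ₁(ζ₀)H_{1,k}B′⟩ ≧ γ₀/(2d(100M)^{d+1})‖B′‖²»*) at `d = 4` for every gauge-fixed `B′` IS the positivity input with the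
instance-independent `γ = γ₀/(8·100⁵)` (n12-b's `B15Prop1FromModel.hpos_of_ineq19`); the contraction smallness is then read with
that `γ`. [cite: Balaban1989LargeFieldII, (1.9) p.358, p.359; Balaban1989LargeFieldI, Prop. 1 (1.78) p.194] -/
theorem prop1Printed_lfVarOfModel_of_ineq19 [∀ i, FiniteDimensional ℝ (E i)] (D : ChartDatum ι Bd E F)
    (hP2 : ∀ i x, D.P₀ i (D.P₀ i x) = D.P₀ i x) (hPsa : ∀ i (x y : E i), ⟪D.P₀ i x, y⟫ = ⟪x, D.P₀ i y⟫)
    (hadj : ∀ i W (x : E i) (y : F i), ⟪D.H i W x, y⟫ = ⟪x, D.Hst i W y⟫)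
    {γ₀ h₁ hst cJ a b : ℝ} (hγ₀ : 0 < γ₀) (hh₁ : 0 ≤ h₁) (hhst : 0 ≤ hst) (hcJ : 0 ≤ cJ) (ha : 0 ≤ a) (hb : 0 ≤ b)
    {ℓ ρ eA : ι → ℝ} (hℓ : ∀ i, 0 ≤ ℓ i) (hr : ∀ i, 0 < D.r i) (heA : ∀ i, 0 < eA i) (hM : ∀ i, 1 ≤ D.M i)
    (h19 : ∀ i W x, D.P₀ i x = x →
      B16Sect1Wilson.Ineq19 ⟪D.H i W x, D.Δ₁ i W (D.H i W x)⟫ (‖x‖ ^ 2) γ₀ 4 (D.M i))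
    (hH : ∀ i W x, ‖D.H i W x‖ ≤ h₁ * ‖x‖) (hHst : ∀ i W z, ‖D.Hst i W z‖ ≤ hst * ‖z‖)
    (hdV0 : ∀ i W, D.dV i W 0 = 0)
    (hdV : ∀ i W (u v : F i), ‖u‖ ≤ ρ i → ‖v‖ ≤ ρ i → ‖D.dV i W u - D.dV i W v‖ ≤ ℓ i * ‖u - v‖)
    (hρ : ∀ i, h₁ * D.r i ≤ ρ i) (hsmall : ∀ i, D.M i ^ 5 / (γ₀ / (8 * 100 ^ 5)) * hst * ℓ i * h₁ ≤ 1 / 2)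
    (hA : ∀ i W (X δ : E i), HasDerivAt (fun s : ℝ => D.A i W (X + s • δ))
      (⟪δ, D.Hst i W (D.J i W)⟫ + ⟪δ, D.Hst i W (D.Δ₁ i W (D.H i W X))⟫ + ⟪δ, D.Hst i W (D.dV i W (D.H i W X))⟫) 0)
    (hJ : ∀ i ε W, 0 < ε → D.Reg i ε W → ‖D.J i W‖ ≤ cJ * ε)
    (hdev : ∀ i ε W (B : GaugeBall (D.P₀ i) (D.r i)), 0 < ε → D.Reg i ε W →
      D.dev i (D.chart i W B) ≤ a * ‖(B.1 : E i)‖ + b * D.M i ^ 2 * ε)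
    (hAn : ∀ i ε W, 0 < ε → ε ≤ eA i → D.Reg i ε W → D.AnExt i ε W) :
    B15.Prop1Printed (lfVarOfModel D) := by
  have hγ : 0 < γ₀ / (8 * 100 ^ 5) := by positivity
  have hpos : ∀ i W x, D.P₀ i x = x →
      γ₀ / (8 * 100 ^ 5) / D.M i ^ 5 * ‖x‖ ^ 2 ≤ ⟪D.H i W x, D.Δ₁ i W (D.H i W x)⟫ :=
    fun i W => B15Prop1FromModel.hpos_of_ineq19 (D.P₀ i) (D.H i W) (D.Δ₁ i W) (lt_of_lt_of_le one_pos (hM i)) (h19 i W)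
  exact prop1Printed_lfVarOfModel D hP2 hPsa hadj hγ hh₁ hhst hcJ ha hb hℓ hr heA hM hpos hH hHst hdV0 hdV hρ hsmall hA
    hJ hdev hAn

/-- **The same under the `ℓ²` reading of the current** (cell GAPS G-B16-02): with `‖J i W‖ ≤ cJ·(M i)²·ε` (`|Λ| ≤ (100M)⁴`
sites, pointwise `O(ε)`) and the cube size bounded along the family, `M i ≤ M₀` ([IV] p. 177: `M` is ONE constant of the
procedure), `B15.Prop1Printed (lfVarOfModel D)` holds with `B₅ = 2·a·hst·(cJ·M₀²)/γ + b + 1` — print's exponent 5, the extra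
`M²` absorbed (*«The power M⁵ is not the optimal one»*, p. 195). [cite: Balaban1989LargeFieldI, Prop. 1 (1.78) p.194, p.195;
Balaban1989LargeFieldII, p.359] -/
theorem prop1Printed_lfVarOfModel_ell2 [∀ i, FiniteDimensional ℝ (E i)] (D : ChartDatum ι Bd E F)
    (hP2 : ∀ i x, D.P₀ i (D.P₀ i x) = D.P₀ i x) (hPsa : ∀ i (x y : E i), ⟪D.P₀ i x, y⟫ = ⟪x, D.P₀ i y⟫)
    (hadj : ∀ i W (x : E i) (y : F i), ⟪D.H i W x, y⟫ = ⟪x, D.Hst i W y⟫)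
    {γ h₁ hst cJ a b M₀ : ℝ} (hγ : 0 < γ) (hh₁ : 0 ≤ h₁) (hhst : 0 ≤ hst) (hcJ : 0 ≤ cJ) (ha : 0 ≤ a) (hb : 0 ≤ b)
    {ℓ ρ eA : ι → ℝ} (hℓ : ∀ i, 0 ≤ ℓ i) (hr : ∀ i, 0 < D.r i) (heA : ∀ i, 0 < eA i) (hM : ∀ i, 1 ≤ D.M i)
    (hM₀ : ∀ i, D.M i ≤ M₀)
    (hpos : ∀ i W x, D.P₀ i x = x → γ / D.M i ^ 5 * ‖x‖ ^ 2 ≤ ⟪D.H i W x, D.Δ₁ i W (D.H i W x)⟫)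
    (hH : ∀ i W x, ‖D.H i W x‖ ≤ h₁ * ‖x‖) (hHst : ∀ i W z, ‖D.Hst i W z‖ ≤ hst * ‖z‖)
    (hdV0 : ∀ i W, D.dV i W 0 = 0)
    (hdV : ∀ i W (u v : F i), ‖u‖ ≤ ρ i → ‖v‖ ≤ ρ i → ‖D.dV i W u - D.dV i W v‖ ≤ ℓ i * ‖u - v‖)
    (hρ : ∀ i, h₁ * D.r i ≤ ρ i) (hsmall : ∀ i, D.M i ^ 5 / γ * hst * ℓ i * h₁ ≤ 1 / 2)
    (hA : ∀ i W (X δ : E i), HasDerivAt (fun s : ℝ => D.A i W (X + s • δ))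
      (⟪δ, D.Hst i W (D.J i W)⟫ + ⟪δ, D.Hst i W (D.Δ₁ i W (D.H i W X))⟫ + ⟪δ, D.Hst i W (D.dV i W (D.H i W X))⟫) 0)
    (hJ : ∀ i ε W, 0 < ε → D.Reg i ε W → ‖D.J i W‖ ≤ cJ * D.M i ^ 2 * ε)
    (hdev : ∀ i ε W (B : GaugeBall (D.P₀ i) (D.r i)), 0 < ε → D.Reg i ε W →
      D.dev i (D.chart i W B) ≤ a * ‖(B.1 : E i)‖ + b * D.M i ^ 2 * ε)
    (hAn : ∀ i ε W, 0 < ε → ε ≤ eA i → D.Reg i ε W → D.AnExt i ε W) :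
    B15.Prop1Printed (lfVarOfModel D) := by
  -- the `ℓ²` letter `cJ·M²` is dominated by the `M`-free letter `cJ·M₀²`
  have hJ' : ∀ i ε W, 0 < ε → D.Reg i ε W → ‖D.J i W‖ ≤ cJ * M₀ ^ 2 * ε := by
    intro i ε W hε hW
    have hMi : D.M i ^ 2 ≤ M₀ ^ 2 := pow_le_pow_left₀ (zero_le_one.trans (hM i)) (hM₀ i) 2
    calc ‖D.J i W‖ ≤ cJ * D.M i ^ 2 * ε := hJ i ε W hε hW
      _ ≤ cJ * M₀ ^ 2 * ε := mul_le_mul_of_nonneg_right (mul_le_mul_of_nonneg_left hMi hcJ) hε.le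
  exact prop1Printed_lfVarOfModel D hP2 hPsa hadj hγ hh₁ hhst (mul_nonneg hcJ (sq_nonneg _)) ha hb hℓ hr heA hM hpos hH
    hHst hdV0 hdV hρ hsmall hA hJ' hdev hAn

end Carrier

/-! ## §3 A model instance at which every input is discharged (non-vacuity) -/

section Scalar

/-- The real inner product on `ℝ` is multiplication (plumbing for the scalar model; private). [folklore] -/
private theorem real_inner_eq_mul_self (x y : ℝ) : ⟪x, y⟫ = x * y := by
  simp [mul_comm]

/-- One-variable calculus: `s ↦ α + βs + γs²` has derivative `β` at `0` (plumbing for (m5) in the scalar model; private). [folklore] -/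
private theorem hasDerivAt_quadratic_zero (α β γ : ℝ) : HasDerivAt (fun s : ℝ => α + β * s + γ * s ^ 2) β 0 := by
  have h1 : HasDerivAt (fun s : ℝ => α + β * s) β 0 := by
    simpa using ((hasDerivAt_id' (0 : ℝ)).const_mul β).const_add α
  have h2 : HasDerivAt (fun s : ℝ => γ * s ^ 2) 0 0 := by
    simpa using (hasDerivAt_pow 2 (0 : ℝ)).const_mul γ
  simpa [Pi.add_def] using h1.add h2

/-- **The one-instance scalar model of p. 359** (a satisfiability witness, not physics): one instance (`ι = PUnit`), boundary
data, `B′`-fields and fine-lattice fields all real numbers (`Bd = E = F = ℝ`), cube size `M = 1`, chart radius `r = 1`, no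
gauge condition (`P₀ = 1`), `H = H* = Δ₁ = 1`, `V = 0` (so `(δ/δA)V = 0`), the current of a boundary datum IS the datum
(`J W = W`), the function of (1.77) in the chart `A W B′ = W·B′ + B′²/2` (constant + current + quadratic, the printed expansion
with `V = 0`), orbits = the chart ball with the identity chart, `Reg ε W := |W| ≤ ε`, deviation `dev B′ = |B′|`, and the
analytic-extension clause `AnExt ε W :=` «the critical configuration `W ↦ −W` is real-analytic at `W`». [cite: Balaban1989LargeFieldII,
p.359 (proof of Proposition 1 [IV]); Balaban1989LargeFieldI, Prop. 1 p.194] -/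
def scalarDatum : ChartDatum PUnit (fun _ => ℝ) (fun _ => ℝ) (fun _ => ℝ) where
  M _ := 1
  r _ := 1
  P₀ _ := LinearMap.id
  H _ _ := LinearMap.id
  Hst _ _ := LinearMap.id
  Δ₁ _ _ := LinearMap.id
  dV _ _ := fun _ => 0
  J _ W := W
  A _ W B := W * B + B ^ 2 / 2
  Cfg _ := GaugeBall (LinearMap.id : ℝ →ₗ[ℝ] ℝ) 1
  chart _ _ := Equiv.refl _
  Reg _ ε W := |W| ≤ ε
  dev _ O := |O.1|
  AnExt _ _ W := AnalyticAt ℝ (fun w : ℝ => -w) W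

/-- **`B15.Prop1Printed` of the scalar model's carrier, UNCONDITIONALLY**: every input (m1)–(m5), (d4), (x) of
`prop1Printed_lfVarOfModel` is DISCHARGED at `scalarDatum` (positivity with `γ = 1`, `‖H‖, ‖H*‖ ≤ 1`, `(δ/δA)V = 0` is
`0`-Lipschitz, the current of an `ε`-regular datum has norm `≤ 1·ε`, the first variation of `W·B′ + B′²/2` is
`⟨δ, W⟩ + ⟨δ, B′⟩ + ⟨δ, 0⟩`, the deviation of the orbit charted by `B′` is `|B′| ≤ 1·‖B′‖ + 0`, the map `W ↦ −W` is analytic) — so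
the hypothesis set of §2 is jointly satisfiable and the typed Proposition 1 is inhabited by a carrier with instances and
orbits. [cite: Balaban1989LargeFieldI, Prop. 1 (1.78) p.194; Balaban1989LargeFieldII, p.359] -/
theorem prop1Printed_scalarDatum : B15.Prop1Printed (lfVarOfModel scalarDatum) := by
  refine prop1Printed_lfVarOfModel scalarDatum (γ := 1) (h₁ := 1) (hst := 1) (cJ := 1) (a := 1) (b := 0)
    (ℓ := fun _ => 0) (ρ := fun _ => 1) (eA := fun _ => 1)
    (fun _ _ => rfl) (fun _ _ _ => rfl) (fun _ _ _ _ => rfl) one_pos zero_le_one zero_le_one zero_le_one zero_le_one le_rfl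
    (fun _ => le_rfl) (fun _ => one_pos) (fun _ => one_pos) (fun _ => le_rfl) ?_ ?_ ?_ (fun _ _ => rfl) ?_ ?_ ?_ ?_ ?_ ?_ ?_
  · -- (m1) positivity: `1/1⁵·‖x‖² ≤ ⟨x, x⟩`
    intro i W x _
    show (1 : ℝ) / 1 ^ 5 * ‖x‖ ^ 2 ≤ ⟪x, x⟫
    rw [real_inner_self_eq_norm_sq]
    norm_num
  · -- (m2) `‖H x‖ ≤ 1·‖x‖`
    intro i W x
    show ‖x‖ ≤ 1 * ‖x‖
    rw [one_mul]
  · -- (m2) `‖H* z‖ ≤ 1·‖z‖`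
    intro i W z
    show ‖z‖ ≤ 1 * ‖z‖
    rw [one_mul]
  · -- (m3) `(δ/δA)V = 0` is `0`-Lipschitz
    intro i W u v _ _
    show ‖(0 : ℝ) - 0‖ ≤ 0 * ‖u - v‖
    simp
  · -- room `h₁·r ≤ ρ`
    intro i
    show (1 : ℝ) * 1 ≤ 1
    norm_num
  · -- contraction smallness
    intro i
    show (1 : ℝ) ^ 5 / 1 * 1 * 0 * 1 ≤ 1 / 2
    norm_num
  · -- (m5) the first variation of `W·B′ + B′²/2`
    intro i W X δ
    show HasDerivAt (fun s : ℝ => W * (X + s • δ) + (X + s • δ) ^ 2 / 2) (⟪δ, W⟫ + ⟪δ, X⟫ + ⟪δ, (0 : ℝ)⟫) 0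
    have h := hasDerivAt_quadratic_zero (W * X + X ^ 2 / 2) (W * δ + X * δ) (δ ^ 2 / 2)
    have hfun : (fun s : ℝ => W * (X + s • δ) + (X + s • δ) ^ 2 / 2) =
        fun s : ℝ => W * X + X ^ 2 / 2 + (W * δ + X * δ) * s + δ ^ 2 / 2 * s ^ 2 := by
      funext s
      simp only [smul_eq_mul]
      ring
    have hval : ⟪δ, W⟫ + ⟪δ, X⟫ + ⟪δ, (0 : ℝ)⟫ = W * δ + X * δ := by
      simp only [real_inner_eq_mul_self]
      ring
    rw [hfun, hval]
    exact h
  · -- (m4) the current of an `ε`-regular datum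
    intro i ε W _ hW
    show ‖W‖ ≤ 1 * ε
    rw [one_mul, Real.norm_eq_abs]
    exact hW
  · -- (d4) the deviation of the orbit charted by `B′`
    intro i ε W B hε _
    show |B.1| ≤ 1 * ‖B.1‖ + 0 * (1 : ℝ) ^ 2 * ε
    rw [Real.norm_eq_abs]
    linarith
  · -- (x) `W ↦ −W` is real-analytic
    intro i ε W _ _ _
    exact analyticAt_id.neg

/-- **The scalar model is NON-DEGENERATE** (A2 reading of `prop1Printed_scalarDatum`): its carrier HAS an instance, every
orbit type has two distinct orbits (`B′ = 0` and `B′ = 1`), at every `ε > 0` there is an `ε`-regular boundary datum `W ≠ 0`,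
and for every boundary datum `W` of the chart the orbit `B′` is critical EXACTLY WHEN `B′ = −W` — so «there exists exactly
one critical orbit … It satisfies … (1.78)» is a statement with content on this carrier (contrast the residual inhabitant
`Node00.nonempty_residW`, whose Proposition-1 carrier has NO instances and satisfies `Prop1Printed` vacuously, and
`Node00.not_b15Leaf_WOfRecord₁₀_swapLF`, whose carrier has no orbits and refutes it). [cite: Balaban1989LargeFieldI, Prop. 1
(1.78) p.194 (non-vacuity bookkeeping)] -/
theorem scalarDatum_nondegenerate :
    Nonempty (lfVarOfModel scalarDatum).Inst ∧
    (∀ i, ∃ O O' : (lfVarOfModel scalarDatum).Orbit i, O ≠ O') ∧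
    (∀ i (ε : ℝ), 0 < ε → ∃ W : ℝ, W ≠ 0 ∧ (lfVarOfModel scalarDatum).Regular i ε W) ∧
    (∀ i (W : ℝ) (O : (lfVarOfModel scalarDatum).Orbit i),
      (lfVarOfModel scalarDatum).IsCritical i W O ↔ (O.1 : ℝ) = -W) := by
  refine ⟨⟨PUnit.unit⟩, fun i => ?_, fun i ε hε => ⟨ε, hε.ne', ?_⟩, fun i W O => ?_⟩
  · refine ⟨⟨0, rfl, by norm_num⟩, ⟨1, rfl, by norm_num⟩, fun h => ?_⟩
    have h1 := congrArg Subtype.val h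
    norm_num at h1
  · show |ε| ≤ ε
    rw [abs_of_pos hε]
  · show (∀ δB : ℝ, δB = δB → ⟪δB, W⟫ + ⟪δB, O.1⟫ + ⟪δB, (0 : ℝ)⟫ = 0) ↔ O.1 = -W
    constructor
    · intro h
      have h1 := h 1 rfl
      simp only [real_inner_eq_mul_self, one_mul, mul_zero, add_zero] at h1
      linarith
    · intro h δB _
      simp only [real_inner_eq_mul_self, h, mul_zero, add_zero]
      ring

end Scalar

/-! ## §4 (v1.1, append-only, 2026-08-26) The positivity input (m1) from the printed inputs of (1.9) — (1.67) [10],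
the two perturbation steps of p. 357 ((1.7)) and (1.8) — BY NAME (`B16Ineq17Assembly.ineq19_of_inputs`, new import), and
`‖H_{1,k}‖ ≤ hst` DERIVED from `‖H*_{1,k}‖ ≤ hst` (`B15Prop1Minimum.norm_le_of_adjoint`): two letters fewer -/

section Inputs1718

variable {ι : Type} {Bd E F : ι → Type}
  [∀ i, NormedAddCommGroup (E i)] [∀ i, InnerProductSpace ℝ (E i)]
  [∀ i, NormedAddCommGroup (F i)] [∀ i, InnerProductSpace ℝ (F i)]

/-- **`B15.Prop1Printed` of the model carrier with (1.9) ASSEMBLED FROM ITS PRINTED INPUTS and the `H`-bound derived.**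
p. 357–358: *«Now the leading quadratic form is equal to ⟨B′, Δ_kB′⟩ defined by (1.65), (1.66) [10]. Using the bound (1.67)
[10] for this form, we obtain (1.7) … Consider the quadratic form ‖∂B′‖² on the fields B′ defined on Λ, and equal to 0 on
bonds of the graph G₀ … we obtain the inequality (1.8) … The inequalities (1.7), (1.8) imply finally (1.9) for g_k
sufficiently small.»*  Per instance `i` and boundary datum `W`, with the LEADING FORM `Qk i W B′ = ⟨B′, Δ_kB′⟩` of [10] and
the plaquette-derivative size `ndB i B′ = ‖∂B′‖²` as letters: the (1.67)-instance `γ₀·ndB ≤ Qk` (row B5.Eq1.67; on the unit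
torus `B5Bounds167Lattice.ineq167` gives it with `γ₀ = (4/π²)^{d+2}`), the combined perturbation letter of p. 357
`|⟨HB′, Δ₁HB′⟩ − Qk| ≤ C(M⁶R_kε_k + e^{−R_k})‖B′‖²` (first order in `A₀` + replacement of the minimizer ∕ `ζ₀`), (1.8) on the
gauge subspace in r13's shape `Ineq18 ‖B′‖² ‖∂B′‖² 4 M` (PROVED for cubic `Λ` in the comb gauge:
`B16Sect1Wilson.ineq18_cube_vec`), and print's *«for g_k sufficiently small»* as `C(M⁶R_kε_k + e^{−R_k}) ≤ γ₀/(8(100M)⁵)` give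
(1.9) at `d = 4` (`B16Ineq17Assembly.ineq19_of_inputs` BY NAME), hence (m1) with `γ = γ₀/(8·100⁵)`; and `‖H_{1,k}B′‖ ≤
hst‖B′‖` follows from `‖H*‖ ≤ hst` and adjointness (`B15Prop1Minimum.norm_le_of_adjoint`), so the `h₁`-letter of §2 is `hst`.
The other inputs (m3)–(m5), (d4), (x) as in `prop1Printed_lfVarOfModel`. [cite: Balaban1989LargeFieldII, (1.7)–(1.9)
pp.357–358, p.359; Balaban1984PropagatorsI, (1.67) p.29; Balaban1989LargeFieldI, Prop. 1 (1.78) p.194] -/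
theorem prop1Printed_lfVarOfModel_of_inputs17_18 [∀ i, FiniteDimensional ℝ (E i)] (D : ChartDatum ι Bd E F)
    (hP2 : ∀ i x, D.P₀ i (D.P₀ i x) = D.P₀ i x) (hPsa : ∀ i (x y : E i), ⟪D.P₀ i x, y⟫ = ⟪x, D.P₀ i y⟫)
    (hadj : ∀ i W (x : E i) (y : F i), ⟪D.H i W x, y⟫ = ⟪x, D.Hst i W y⟫)
    {γ₀ C hst cJ a b : ℝ} (hγ₀ : 0 < γ₀) (hhst : 0 ≤ hst) (hcJ : 0 ≤ cJ) (ha : 0 ≤ a) (hb : 0 ≤ b)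
    {ℓ ρ eA Rk εk : ι → ℝ} (hℓ : ∀ i, 0 ≤ ℓ i) (hr : ∀ i, 0 < D.r i) (heA : ∀ i, 0 < eA i) (hM : ∀ i, 1 ≤ D.M i)
    (Qk : (i : ι) → Bd i → E i → ℝ) (ndB : (i : ι) → E i → ℝ)
    (h167 : ∀ i W x, γ₀ * ndB i x ≤ Qk i W x)
    (hpert : ∀ i W x, |⟪D.H i W x, D.Δ₁ i W (D.H i W x)⟫ - Qk i W x| ≤
      C * (D.M i ^ 6 * Rk i * εk i + Real.exp (-Rk i)) * ‖x‖ ^ 2)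
    (h18 : ∀ i x, D.P₀ i x = x → B16Sect1Wilson.Ineq18 (‖x‖ ^ 2) (ndB i x) 4 (D.M i))
    (hgk : ∀ i, C * (D.M i ^ 6 * Rk i * εk i + Real.exp (-Rk i)) ≤ γ₀ / (8 * (100 * D.M i) ^ 5))
    (hHst : ∀ i W z, ‖D.Hst i W z‖ ≤ hst * ‖z‖) (hdV0 : ∀ i W, D.dV i W 0 = 0)
    (hdV : ∀ i W (u v : F i), ‖u‖ ≤ ρ i → ‖v‖ ≤ ρ i → ‖D.dV i W u - D.dV i W v‖ ≤ ℓ i * ‖u - v‖)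
    (hρ : ∀ i, hst * D.r i ≤ ρ i) (hsmall : ∀ i, D.M i ^ 5 / (γ₀ / (8 * 100 ^ 5)) * hst * ℓ i * hst ≤ 1 / 2)
    (hA : ∀ i W (X δ : E i), HasDerivAt (fun s : ℝ => D.A i W (X + s • δ))
      (⟪δ, D.Hst i W (D.J i W)⟫ + ⟪δ, D.Hst i W (D.Δ₁ i W (D.H i W X))⟫ + ⟪δ, D.Hst i W (D.dV i W (D.H i W X))⟫) 0)
    (hJ : ∀ i ε W, 0 < ε → D.Reg i ε W → ‖D.J i W‖ ≤ cJ * ε)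
    (hdev : ∀ i ε W (B : GaugeBall (D.P₀ i) (D.r i)), 0 < ε → D.Reg i ε W →
      D.dev i (D.chart i W B) ≤ a * ‖(B.1 : E i)‖ + b * D.M i ^ 2 * ε)
    (hAn : ∀ i ε W, 0 < ε → ε ≤ eA i → D.Reg i ε W → D.AnExt i ε W) :
    B15.Prop1Printed (lfVarOfModel D) := by
  -- `‖H‖ ≤ hst` from the adjoint
  have hH : ∀ i W x, ‖D.H i W x‖ ≤ hst * ‖x‖ := fun i W x =>
    B15Prop1Minimum.norm_le_of_adjoint (D.H i W) (D.Hst i W) (hadj i W) hhst (hHst i W) x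
  -- (1.9) at `d = 4` from (1.67), the perturbation letter, (1.8) and the smallness
  have h19 : ∀ i W x, D.P₀ i x = x →
      B16Sect1Wilson.Ineq19 ⟪D.H i W x, D.Δ₁ i W (D.H i W x)⟫ (‖x‖ ^ 2) γ₀ 4 (D.M i) := by
    intro i W x hx
    have hM0 : 0 < D.M i := lt_of_lt_of_le one_pos (hM i)
    have e : γ₀ / (8 * (100 * D.M i) ^ 5) = γ₀ / (2 * ((4 : ℕ) : ℝ) * (100 * D.M i) ^ (4 + 1)) := by norm_num
    exact B16Ineq17Assembly.ineq19_of_inputs (by norm_num) hM0 hγ₀.le (sq_nonneg _) (h167 i W x) (hpert i W x)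
      (h18 i x hx) ((hgk i).trans_eq e)
  exact prop1Printed_lfVarOfModel_of_ineq19 D hP2 hPsa hadj hγ₀ hhst hhst hcJ ha hb hℓ hr heA hM h19 hH hHst hdV0 hdV
    hρ hsmall hA hJ hdev hAn

end Inputs1718

end Literature.MathematicalPhysics.QuantumFieldTheory.Balaban1983to89.B15Prop1ModelCarrier

end
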